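import Summits.AtomisticToContinuum.Crystallization.Theorems.OverbindingBudgetGradedBareness

/-!
# OverbindingBudget — node «RecurrentSeal», statements: the recurrent normal form of law 4, hull bookkeeping, translation covariance
(decomp-a2c lens 4, generation 21; helper `--supports stmt-AtomisticToContinuum-31280`; part of the node «RecurrentSeal», whose
statement and reading are in `…Theorems.OverbindingBudgetRecurrentSeal`)

§F the statements `UniformlyRecurrent`, `RobustlySealedDense`, `RecurrentSealedChargeLaw` (law 4 = `SealedChargeLaw` of
`…WallTensionLever` on its extremal class: rooted, uniformly recurrent, robustly sealed textures; no `MAT` / `ThinCores`), the hull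
conditions `FlatMod`, `WSeal` and the hull family `Hull`;  §G margins, coordinates and translation covariance of every hull condition.
The reduction `RecurrentSealedChargeLaw W₀ P₀ → SealedChargeLaw W₀ P₀ r₀` is `…OverbindingBudgetRecurrentSeal`.
-/

noncomputable section

namespace Summit.AtomisticToContinuum.Crystallization.Theorems.OverbindingBudgetRecurrentSealStatements

open Filter Metric Set Topology
open Literature.MathematicalPhysics.StatisticalMechanics
open Literature.Geometry.DiscreteGeometry (ShellCloseTo fccKissingPattern hcpKissingPattern EtaMatched
  card_eq_twelve_of_shellCloseTo)
open Summit.AtomisticToContinuum.Crystallization.Theorems.OverbindingBudgetWallTensionLever (CleanT TouchT Linked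
  SealedDense MAT ThinCores BarlowClose SealedChargeLaw WallTension sealedChargeLaw_numerals_iff cube_subset_closedBall)
open Summit.AtomisticToContinuum.Crystallization.Theorems.OverbindingBudgetGradedBareness (cleanT_anti)
open Summit.AtomisticToContinuum.Crystallization.Theorems.OverbindingBudgetCleanlessCut (margin_le_of_cleanT)
open Summit.AtomisticToContinuum.Crystallization.Theorems.OverbindingBudgetExcessInstability (finite_inter_cube)

/-! ## §F  The statements: the recurrent normal form of law 4 -/

/-- **Uniform (rooted) recurrence** in the local matching topology (the conclusion of the hull engine
`minimalRecurrent`): for every radius `R` and precision `ε > 0` there is `G` such that within `G` of every site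
`w ∈ Y` there is a site `g ∈ Y` whose re-rooted texture `Y - g` is two-way `ε`-matched to `Y` on `B(0, R)`
(every `R`-patch recurs with bounded gaps, up to `ε`). [folklore: Birkhoff / Baake–Grimm 2013 §4, §5.1] -/
def UniformlyRecurrent (Y : Set (EuclideanSpace ℝ (Fin 3))) : Prop :=
  ∀ R ε : ℝ, 0 < ε → ∃ G : ℝ, ∀ w ∈ Y, ∃ g ∈ Y, dist g w ≤ G ∧ Match ε R 0 ((fun p => p - g) '' Y) Y

/-- **Robustly sealed pairs, `L`-densely** (the limit-stable form of `SealedDense`): within `L` of every site there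
is a pair of `t`-robustly clean sites `y, y'` at distance `≤ W` that are NOT joined by a contact path of `≤ P`
robustly clean sites at ANY positive margin `s` (for `SealedDense` the path sites may even be `t`-LOOSENED clean,
margin `-t`; forbidding only robust paths is weaker sealing, hence a wider class of textures). -/
def RobustlySealedDense (a t W : ℝ) (P : ℕ) (Y : Set (EuclideanSpace ℝ (Fin 3))) : Prop :=
  ∃ L : ℝ, ∀ p ∈ Y, ∃ y ∈ Y, ∃ y' ∈ Y, dist y p ≤ L ∧ CleanT a t Y y ∧ CleanT a t Y y' ∧
    dist y y' ≤ W ∧ ∀ s : ℝ, 0 < s → ¬ Linked a s P Y y y'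

/-- **`RecurrentSealedChargeLaw W₀ P₀` — law 4 on its extremal class.**  For the limiting energy density `e`:
every uniformly discrete, ROOTED (`0 ∈ Y`), UNIFORMLY RECURRENT texture that is `9/10`-covering and carries, at a
spacing `a ∈ [47/50, 1]` and margin `t > 0`, `L`-dense robustly sealed pairs of width `≤ W₀ + 1` (non-linkage by
`≤ P₀`-step contact paths of robustly clean sites at every positive margin) has cubes of arbitrarily large side with
site charge `∑ (φ_Y − 2e) > η ℓ³` for one `η > 0`.  No Barlow-matrix (`MAT`) or thin-core hypothesis is needed. -/
def RecurrentSealedChargeLaw (W₀ : ℝ) (P₀ : ℕ) : Prop :=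
  ∀ e : ℝ, Filter.Tendsto (fun N : ℕ => groundStateEnergy lennardJones 3 N / N) Filter.atTop (nhds e) →
    (∀ N : ℕ, 0 < N → e ≤ groundStateEnergy lennardJones 3 N / N) →
    ∀ Y : Set (EuclideanSpace ℝ (Fin 3)), UniformlyDiscrete Y → (0 : (EuclideanSpace ℝ (Fin 3))) ∈ Y → UniformlyRecurrent Y →
      (∀ z : (EuclideanSpace ℝ (Fin 3)), ∃ w ∈ Y, dist z w ≤ 9 / 10) →
      ∀ a : ℝ, 47 / 50 ≤ a → a ≤ 1 → ∀ t : ℝ, 0 < t → RobustlySealedDense a t (W₀ + 1) P₀ Y →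
        ∃ η : ℝ, 0 < η ∧ ∀ ℓ₀ : ℝ, ∃ ℓ : ℝ, ∃ c : (EuclideanSpace ℝ (Fin 3)), ∃ F : Finset (EuclideanSpace ℝ (Fin 3)), ℓ₀ ≤ ℓ ∧
          (↑F : Set (EuclideanSpace ℝ (Fin 3))) = Y ∩ {z | ∀ i : Fin 3, c i ≤ z i ∧ z i < c i + ℓ} ∧
          η * ℓ ^ 3 < ∑ y ∈ F, ((∑' w : ↥Y, lennardJones (dist y (w : (EuclideanSpace ℝ (Fin 3))))) - 2 * e)

/-! ## §F (ii)  Hull bookkeeping: flatness with a modulus, robust sealing at all margins below `t`, the hull family -/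

/-- Flatness with modulus `m`: for every `η > 0`, every half-open cube of side `ℓ ≥ m η` carries site charge
`∑ (φ_Y − 2e) ≤ η ℓ³` (the negation of the law's conclusion, with the threshold side made explicit). -/
def FlatMod (e : ℝ) (m : ℝ → ℝ) (Y : Set (EuclideanSpace ℝ (Fin 3))) : Prop :=
  ∀ η : ℝ, 0 < η → ∀ ℓ : ℝ, ∀ c : (EuclideanSpace ℝ (Fin 3)), ∀ F : Finset (EuclideanSpace ℝ (Fin 3)), m η ≤ ℓ →
    (↑F : Set (EuclideanSpace ℝ (Fin 3))) = Y ∩ {z | ∀ i : Fin 3, c i ≤ z i ∧ z i < c i + ℓ} →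
    ∑ y ∈ F, ((∑' w : ↥Y, lennardJones (dist y (w : (EuclideanSpace ℝ (Fin 3))))) - 2 * e) ≤ η * ℓ ^ 3

/-- The hull-stable sealing condition: `L`-dense pairs, robustly clean at EVERY margin `s ∈ (0, t)`, width `≤ W`,
not linked at any positive margin. -/
def WSeal (a t W : ℝ) (P : ℕ) (L : ℝ) (Y : Set (EuclideanSpace ℝ (Fin 3))) : Prop :=
  ∀ p ∈ Y, ∃ y ∈ Y, ∃ y' ∈ Y, dist y p ≤ L ∧ (∀ s : ℝ, 0 < s → s < t → CleanT a s Y y ∧ CleanT a s Y y') ∧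
    dist y y' ≤ W ∧ ∀ s : ℝ, 0 < s → ¬ Linked a s P Y y y'

/-- The hull family of the reduction: rooted, `δ`-separated, `9/10`-covering, hull-stably sealed, flat. -/
def Hull (δ a t W : ℝ) (P : ℕ) (L e : ℝ) (m : ℝ → ℝ) : Set (Set (EuclideanSpace ℝ (Fin 3))) :=
  {Z | (0 : (EuclideanSpace ℝ (Fin 3))) ∈ Z ∧ (∀ p ∈ Z, ∀ q ∈ Z, p ≠ q → δ ≤ dist p q) ∧ (∀ z : (EuclideanSpace ℝ (Fin 3)), ∃ w ∈ Z, dist z w ≤ 9 / 10) ∧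
    WSeal a t W P L Z ∧ FlatMod e m Z}

/-- Unfolding of `Hull`. -/
theorem mem_hull {δ a t W : ℝ} {P : ℕ} {L e : ℝ} {m : ℝ → ℝ} {Z : Set (EuclideanSpace ℝ (Fin 3))} :
    Z ∈ Hull δ a t W P L e m ↔ (0 : (EuclideanSpace ℝ (Fin 3))) ∈ Z ∧ (∀ p ∈ Z, ∀ q ∈ Z, p ≠ q → δ ≤ dist p q) ∧
      (∀ z : (EuclideanSpace ℝ (Fin 3)), ∃ w ∈ Z, dist z w ≤ 9 / 10) ∧ WSeal a t W P L Z ∧ FlatMod e m Z :=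
  Iff.rfl

/-! ## §G  Margins, coordinates -/

/-- `TouchT` is antitone in the margin. -/
theorem touchT_anti {a s s' : ℝ} {p q : (EuclideanSpace ℝ (Fin 3))} (h : s' ≤ s) (hT : TouchT a s p q) : TouchT a s' p q :=
  ⟨hT.1, by linarith [hT.2]⟩

/-- `Linked` is antitone in the margin (down to `-a/50`). -/
theorem linked_anti {a s s' : ℝ} {P : ℕ} {Y : Set (EuclideanSpace ℝ (Fin 3))} {y y' : (EuclideanSpace ℝ (Fin 3))} (ha : 0 < a) (hlo : -(a / 50) ≤ s')
    (h : s' ≤ s) (hL : Linked a s P Y y y') : Linked a s' P Y y y' := by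
  obtain ⟨n, hn, z, hz0, hzn, hcl, hto⟩ := hL
  exact ⟨n, hn, z, hz0, hzn, fun i hi => ⟨(hcl i hi).1, cleanT_anti ha hlo h (hcl i hi).2⟩,
    fun i hi => touchT_anti h (hto i hi)⟩

/-- Coordinatewise closeness controls the Euclidean distance (`√3 ≤ 3`). [folklore] -/
theorem dist_le_three_mul {z c : (EuclideanSpace ℝ (Fin 3))} {r : ℝ} (hr : 0 ≤ r) (h : ∀ i : Fin 3, |z i - c i| ≤ r) :
    dist z c ≤ 3 * r := by
  rw [EuclideanSpace.dist_eq]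
  have hi : ∀ i, dist (z i) (c i) ^ 2 ≤ r ^ 2 := fun i => by
    rw [Real.dist_eq]; nlinarith [h i, abs_nonneg (z i - c i)]
  calc √(∑ i, dist (z i) (c i) ^ 2) ≤ √(∑ _i : Fin 3, r ^ 2) :=
        Real.sqrt_le_sqrt (Finset.sum_le_sum (fun i _ => hi i))
    _ = √(3 * r ^ 2) := by simp
    _ ≤ √((3 * r) ^ 2) := Real.sqrt_le_sqrt (by nlinarith)
    _ = 3 * r := Real.sqrt_sq (by linarith)

/-- A coordinate of a nearby point is nearby. [folklore] -/
theorem abs_coord_sub_le {z w : (EuclideanSpace ℝ (Fin 3))} {ε : ℝ} (h : dist z w ≤ ε) (i : Fin 3) : |z i - w i| ≤ ε := by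
  have := PiLp.dist_apply_le z w i
  rw [Real.dist_eq] at this
  exact this.trans h

/-! ## §G (ii)  Translation covariance -/

/-- Membership in the re-rooted texture `Y - v`. [folklore] -/
theorem mem_translate {Y : Set (EuclideanSpace ℝ (Fin 3))} {v w : (EuclideanSpace ℝ (Fin 3))} : w ∈ (fun p => p - v) '' Y ↔ w + v ∈ Y := by
  constructor
  · rintro ⟨p, hp, rfl⟩; simpa using hp
  · intro h; exact ⟨w + v, h, by simp⟩

/-- Re-rooting by `v` and then by `-v` is the identity. [folklore] -/
theorem translate_translate (Y : Set (EuclideanSpace ℝ (Fin 3))) (v : (EuclideanSpace ℝ (Fin 3))) : (fun p => p - -v) '' ((fun p => p - v) '' Y) = Y := by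
  rw [Set.image_image]
  have : (fun p : (EuclideanSpace ℝ (Fin 3)) => p - v - -v) = id := by funext p; simp
  rw [this, Set.image_id]

/-- Re-rooting preserves `δ`-separation. [folklore] -/
theorem sep_translate {δ : ℝ} {Y : Set (EuclideanSpace ℝ (Fin 3))} (v : (EuclideanSpace ℝ (Fin 3))) (h : ∀ p ∈ Y, ∀ q ∈ Y, p ≠ q → δ ≤ dist p q) :
    ∀ p ∈ (fun p => p - v) '' Y, ∀ q ∈ (fun p => p - v) '' Y, p ≠ q → δ ≤ dist p q := by
  rintro _ ⟨p, hp, rfl⟩ _ ⟨q, hq, rfl⟩ hne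
  rw [dist_sub_right]
  exact h p hp q hq fun heq => hne (by rw [heq])

/-- Re-rooting preserves the covering radius. [folklore] -/
theorem solid_translate {Y : Set (EuclideanSpace ℝ (Fin 3))} (v : (EuclideanSpace ℝ (Fin 3))) (h : ∀ z : (EuclideanSpace ℝ (Fin 3)), ∃ w ∈ Y, dist z w ≤ 9 / 10) :
    ∀ z : (EuclideanSpace ℝ (Fin 3)), ∃ w ∈ (fun p => p - v) '' Y, dist z w ≤ 9 / 10 := by
  intro z
  obtain ⟨w, hw, hd⟩ := h (z + v)
  refine ⟨w - v, ⟨w, hw, rfl⟩, ?_⟩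
  have e : dist z (w - v) = dist (z + v) w := by rw [← dist_sub_right (z + v) w v, add_sub_cancel_right]
  rw [e]; exact hd

/-- the window / shell sets of the re-rooted texture are the translated window / shell sets -/
theorem window_translate (Y : Set (EuclideanSpace ℝ (Fin 3))) (v y : (EuclideanSpace ℝ (Fin 3))) (r : ℝ) :
    {w ∈ (fun p => p - v) '' Y | w ≠ y - v ∧ dist (y - v) w ≤ r} =
      (fun p => p - v) '' {w ∈ Y | w ≠ y ∧ dist y w ≤ r} := by
  ext w
  simp only [Set.mem_setOf_eq, Set.mem_image]
  constructor
  · rintro ⟨⟨p, hp, rfl⟩, hne, hd⟩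
    refine ⟨p, ⟨hp, fun heq => hne (by rw [heq]), ?_⟩, rfl⟩
    rwa [dist_sub_right] at hd
  · rintro ⟨p, ⟨hp, hne, hd⟩, rfl⟩
    exact ⟨⟨p, hp, rfl⟩, fun heq => hne (sub_left_injective heq), by rwa [dist_sub_right]⟩

/-- Re-rooting preserves robust cleanness (windows, gaps and the rescaled shell are translation covariant). [folklore] -/
theorem cleanT_translate {a s : ℝ} {Y : Set (EuclideanSpace ℝ (Fin 3))} {y : (EuclideanSpace ℝ (Fin 3))} (v : (EuclideanSpace ℝ (Fin 3))) (h : CleanT a s Y y) :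
    CleanT a s ((fun p => p - v) '' Y) (y - v) := by
  obtain ⟨h1, h2, T, hT, hTP⟩ := h
  refine ⟨?_, ?_, T, ?_, hTP⟩
  · rw [window_translate, Set.ncard_image_of_injective _ sub_left_injective, h1]
  · rintro _ ⟨w, hw, rfl⟩ hne
    rw [dist_sub_right]
    exact h2 w hw fun heq => hne (by rw [heq])
  · rw [hT, window_translate, Set.image_image]
    refine Set.image_congr fun w _ => ?_
    show a⁻¹ • (w - y) = a⁻¹ • (w - v - (y - v))
    rw [sub_sub_sub_cancel_right]

/-- Re-rooting preserves contacts. [folklore] -/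
theorem touchT_translate {a s : ℝ} {p q : (EuclideanSpace ℝ (Fin 3))} (v : (EuclideanSpace ℝ (Fin 3))) (h : TouchT a s p q) : TouchT a s (p - v) (q - v) :=
  ⟨fun heq => h.1 (sub_left_injective heq), by rw [dist_sub_right]; exact h.2⟩

/-- Re-rooting preserves contact paths of robustly clean sites. [folklore] -/
theorem linked_translate {a s : ℝ} {P : ℕ} {Y : Set (EuclideanSpace ℝ (Fin 3))} {y y' : (EuclideanSpace ℝ (Fin 3))} (v : (EuclideanSpace ℝ (Fin 3))) (h : Linked a s P Y y y') :
    Linked a s P ((fun p => p - v) '' Y) (y - v) (y' - v) := by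
  obtain ⟨n, hn, z, hz0, hzn, hcl, hto⟩ := h
  exact ⟨n, hn, fun i => z i - v, by simp only [hz0], by simp only [hzn],
    fun i hi => ⟨⟨z i, (hcl i hi).1, rfl⟩, cleanT_translate v (hcl i hi).2⟩, fun i hi => touchT_translate v (hto i hi)⟩

/-- the field of the re-rooted texture at the re-rooted site is the field. [folklore] -/
theorem field_translate (Y : Set (EuclideanSpace ℝ (Fin 3))) (v y : (EuclideanSpace ℝ (Fin 3))) :
    (∑' w : ↥((fun p => p - v) '' Y), lennardJones (dist (y - v) (w : (EuclideanSpace ℝ (Fin 3))))) =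
      ∑' w : ↥Y, lennardJones (dist y (w : (EuclideanSpace ℝ (Fin 3)))) := by
  let eqv : ↥Y ≃ ↥((fun p => p - v) '' Y) := Equiv.Set.image (fun p => p - v) Y sub_left_injective
  rw [← Equiv.tsum_eq eqv]
  refine tsum_congr fun w => ?_
  have he : ((eqv w : ↥((fun p => p - v) '' Y)) : (EuclideanSpace ℝ (Fin 3))) = (w : (EuclideanSpace ℝ (Fin 3))) - v := rfl
  rw [he, dist_sub_right]

/-- Re-rooting preserves the hull-stable sealing condition `WSeal`. [folklore] -/
theorem wSeal_translate {a t W : ℝ} {P : ℕ} {L : ℝ} {Y : Set (EuclideanSpace ℝ (Fin 3))} (v : (EuclideanSpace ℝ (Fin 3))) (h : WSeal a t W P L Y) :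
    WSeal a t W P L ((fun p => p - v) '' Y) := by
  intro p hp
  rw [mem_translate] at hp
  obtain ⟨y, hy, y', hy', hd, hcl, hW, hnl⟩ := h (p + v) hp
  refine ⟨y - v, ⟨y, hy, rfl⟩, y' - v, ⟨y', hy', rfl⟩, ?_,
    fun s hs hst => ⟨cleanT_translate v (hcl s hs hst).1, cleanT_translate v (hcl s hs hst).2⟩,
    by rw [dist_sub_right]; exact hW, fun s hs hL => hnl s hs ?_⟩
  · have e : dist (y - v) p = dist y (p + v) := by rw [← dist_sub_right y (p + v) v, add_sub_cancel_right]
    rw [e]; exact hd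
  · have := linked_translate (-v) hL
    rwa [translate_translate, sub_neg_eq_add, sub_add_cancel, sub_neg_eq_add, sub_add_cancel] at this

/-- Re-rooting preserves flatness with a modulus (cubes translate, site sums are re-indexed, fields are covariant). [folklore] -/
theorem flatMod_translate {e : ℝ} {m : ℝ → ℝ} {Y : Set (EuclideanSpace ℝ (Fin 3))} (v : (EuclideanSpace ℝ (Fin 3))) (h : FlatMod e m Y) :
    FlatMod e m ((fun p => p - v) '' Y) := by
  classical
  intro η hη ℓ c F hℓ hF
  have hF' : (↑(F.image (fun p => p + v)) : Set (EuclideanSpace ℝ (Fin 3))) =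
      Y ∩ {z | ∀ i : Fin 3, (c + v) i ≤ z i ∧ z i < (c + v) i + ℓ} := by
    rw [Finset.coe_image, hF]
    ext z
    simp only [Set.mem_image, Set.mem_inter_iff, Set.mem_setOf_eq]
    constructor
    · rintro ⟨w, ⟨hw, hc⟩, rfl⟩
      obtain ⟨x, hx, rfl⟩ := hw
      refine ⟨by rw [sub_add_cancel]; exact hx, fun i => ?_⟩
      have h1 := hc i
      rw [PiLp.sub_apply] at h1
      rw [PiLp.add_apply, sub_add_cancel]
      constructor <;> linarith [h1.1, h1.2]
    · rintro ⟨hz, hc⟩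
      refine ⟨z - v, ⟨⟨z, hz, rfl⟩, fun i => ?_⟩, by rw [sub_add_cancel]⟩
      have h1 := hc i
      rw [PiLp.add_apply] at h1
      rw [PiLp.sub_apply]
      constructor <;> linarith [h1.1, h1.2]
  have h1 := h η hη ℓ (c + v) (F.image (fun p => p + v)) hℓ hF'
  rw [Finset.sum_image (fun x _ y _ hxy => add_right_cancel hxy)] at h1
  have h2 : ∀ y : (EuclideanSpace ℝ (Fin 3)), (∑' w : ↥((fun p => p - v) '' Y), lennardJones (dist y (w : (EuclideanSpace ℝ (Fin 3))))) =
      ∑' w : ↥Y, lennardJones (dist (y + v) (w : (EuclideanSpace ℝ (Fin 3)))) := by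
    intro y
    have := field_translate Y v (y + v)
    rwa [add_sub_cancel_right] at this
  simp_rw [h2]
  exact h1

end Summit.AtomisticToContinuum.Crystallization.Theorems.OverbindingBudgetRecurrentSealStatements

end
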